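import Summits.QuantumFields.BalabanUV.T4Continuum.Support.NE7MinimiserLipschitzLetters
import Summits.QuantumFields.BalabanUV.T4Continuum.Support.NE7FibreStraightening
import Summits.QuantumFields.BalabanUV.T4Continuum.Support.NE7RectangleSecondOrder
import Summits.QuantumFields.BalabanUV.T4Continuum.Support.NE7NearStabiliserTorus
import HarnessLib

/-!
# NE7MinimiserLipschitzStep — THE IMPROVEMENT STEP OF THE «OPTIMAL GAUGE» LOOP (gen 114's 4-POINT SCHEME): over the small data, at every level `j+1` and base `(V₀, U♯)`, there are
# `δ₁ > 0`, `A, B ≥ 0` such that EVENTUALLY as the unitary `N`-periodic datum `V → V₀`: for every minimiser `U` over `V` and every unitary periodic fine gauge `u` whose corner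
# values fix `V₀` and whose copy `X = U^{u}` has bond sum `Ψ(u) = Σ_b ‖U♯(b)⁻¹X(b) − 1‖ ≤ δ₁`, there is another such gauge `u_c` with  `Ψ(u_c) ≤ A·√(‖y(V)‖·Ψ(u)) + B·‖y(V)‖`
# (`y(V) = skewPR N (relLog N V₀ V)`).  MECHANISM: `X = chart Φ_a` (decoding), `(y₁, Φ_a)` with `y₁ = Q̄ Φ_a`, `‖y₁‖ = ‖y(V)‖` (stabiliser invariance); the straightening `θ`
# (`NE7FibreStraightening`) gives competitors `chart θ(0,Φ_a)` over `V₀` and `chart θ(y₁,0)` over `V′`; quadratic growth at `U♯` (✓ p819664) + minimality of `X` over `V′` +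
# the rectangle inequality (`NE7RectangleSecondOrder`) give `c₀‖X′‖_w² ≤ K‖y₁‖‖Φ_a‖` where `chart θ(0,Φ_a)^{u′} = U♯e^{X′}`; the corner gauge `ū′` moves `V₀` by `O(‖X′‖)`, so
# `NE7NearStabiliserTorus.near_stabiliser` gives a stabiliser element `s` within `O(‖X′‖)`; the block-constant gauge `s·ū′⁻¹` followed by `u′` is the competitor

Cell `pub-balaban`, rung (B)+1 sub-cell t4, lineage `b2b-balaban-t4-ne7-p1` (CRUX PROVER NE7 #1 = OWNER of BINDER row NE7), generation 114.  Memo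
`t4/b2b-balaban-t4-ne7-p1-g114/ROAD-G114.md` §4.
WHAT ([folklore]; 0 def, 0 sorry; `d = 4`, every `U(n)`, every `L ≥ 2`).  **`improvement_step`** (statement in the theorem's docstring).
HONEST FRAMING (page 1): soft calculus, compactness and bookkeeping over landed kernel theorems; all constants EXISTENTIAL and NOT uniform in `V₀`, `j`, `N`; nothing of Bałaban's asserted
and NOT his method; finite 4-torus, small data; NOT NE7 as a spine node, NOT NE3; spine 0∕9; NOT infinite volume, NOT mass gap, NOT BetaPertH, NOT Clay.
-/

set_option autoImplicit false

open scoped BigOperators Matrix Matrix.Norms.L2Operator Topology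
open NormedSpace Finset Set Filter Metric

namespace Summit.QuantumFields.BalabanUV.T4Continuum.NE7MinimiserLipschitzStep

open Literature.MathematicalPhysics.QuantumFieldTheory.Balaban1983to89 open B7Prop1Explicit B7Prop2Explicit
open T4AveragingDeficitWall (IsUnitaryCfg IsSkewDir SmallField fineAction vary) open T4AveragingDeficitWallBoundary (IsPeriodicCfg periodBox)
open AveragingDeficitPeriodicCounting (IsPeriodicDir) open AveragingDeficitTorusChart (TDir chart chartDir chart_zero chart_smul redN)
open AveragingDeficitChartCalculus (relLog relLog_self contDiffAt_fineAction_chart) open AveragingDeficitTwoLevelPrep (skewSub skewPR)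
open AveragingDeficitMultiLevelPrep (tower levelQ LevelSmall cavgIter cavgIter_unitary_small isPeriodicCfg_cavgIter natCast_tower_succ)
open AveragingDeficitMultiLevelFermat (continuousAt_cavgIter_chart) open AveragingDeficitMultiLevelBridge (cavgIter_eq_avgIter tower_eq)
open AveragingDeficitKDatum (isUnitaryCfg_gaugeAct) open MinimalActionLevels (perWin levelAction stepWt stepWt_pos)
open MinimalActionSandwich (IsMinimiser admissible) open MinimalActionRate (sfClass)
open NE3EnergyShapes (IsUnitarySite IsPeriodicSite) open NE3EnergyWeightedShapes (energyNormW energyNormW_nonneg)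
open NE3ResidualSliceRep (isPeriodicCfg_gaugeAct) open T4AveragingDeficitWallBoundary (mem_periodBox)
open NE7MinimiserLipschitzLetters (norm_le_pow_mul_energyNormW_of_mem three_piece norm_mul_inv_sub_one corner_fix_mul)
open NE7AdmissibleFibreLHC (period_succ_eq tendsto_skewPR_relLog eventually_near_base) open NE7AdmissibleFibreQuantitativeBase (chart_fibre_quantitative)
open NE7TorusChartDecoding (chart_skewPR_relLog_eq norm_skewPR_relLog_le) open NE7DatumCoordinateStabiliser (norm_skewPR_relLog_gaugeAct_stab near_gaugeAct_stab)
open NE7MinimalOrbitDatumContinuity (thresholds) open NE7OpenOfMinimisation (tanCritical_of_isMinimiser)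
open NE7CriticalOrbitQuadraticGrowthAnyDatum (action_quadratic_growth_any_datum) open NE7EtaMinimiserGaugeCovariance (isMinimiser_gaugeAct avgIter_gaugeAct_sfClass isUnitarySite_corner)
open NE7FibreStraightening (fibre_straightening) open NE7RectangleSecondOrder (rectangle_bound_of_contDiffAt_two)
open NE7NearStabiliserTorus (near_stabiliser)
open NE7MinimiserLipschitzPrep (gaugeAct_mul_fun isPeriodicSite_corner blockConst_corner blockConst_periodic norm_relVal_eq norm_regauge_sub_le
  norm_gaugeAct_sub_gaugeAct norm_chart_sub_chart_le norm_vary_sub_le term_le_sum)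
open BlockAverageCurrent (smallField_gaugeAct) open AveragingDeficitPlaqDeriv (vary_isUnitaryCfg)

noncomputable section

variable {n : Type} [Fintype n] [DecidableEq n]

set_option maxHeartbeats 1600000 in
/-- **THE IMPROVEMENT STEP.**  Over the small data, at every level `j+1` and base datum `V₀`: there is a minimiser `U♯` over `V₀` and `δ₁ > 0`, `A, B ≥ 0` such that EVENTUALLY as the
unitary `N`-periodic datum `V → V₀`, for every minimiser `U` over `V` and every unitary `(N·L^{j+1})`-periodic `u` whose corner values fix `V₀` bondwise and with
`Ψ(u) := Σ_{(r,κ)} ‖U♯(boxVec r, κ)⁻¹·(U^{u})(boxVec r, κ) − 1‖ ≤ δ₁`, there is a unitary periodic `u_c` whose corner values fix `V₀` and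
`Ψ(u_c) ≤ A·√(‖y(V)‖·Ψ(u)) + B·‖y(V)‖`, `y(V) = skewPR N (relLog N V₀ V)`. [folklore] -/
theorem improvement_step [Nonempty n] {L : ℕ} [NeZero L] (hL : 2 ≤ L) :
    ∃ ε₀ : ℝ, 0 < ε₀ ∧ ∀ ε : ℝ, 0 < ε → ε ≤ ε₀ → ∀ (N : ℕ) [NeZero N], 1 ≤ N →
      ∃ δV : ℝ, 0 < δV ∧
        ∀ V₀ ∈ {V : Site 4 → Fin 4 → (Matrix n n ℂ)ˣ | IsUnitaryCfg V ∧ IsPeriodicCfg V (N : ℤ) ∧ SmallField V δV},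
        ∀ j : ℕ, ∃ Us : Site 4 → Fin 4 → (Matrix n n ℂ)ˣ, IsMinimiser 4 (sfClass 4 L N ε) L N (j + 1) V₀ Us ∧ ∃ δ₁ A B : ℝ, 0 < δ₁ ∧ 0 ≤ A ∧ 0 ≤ B ∧
          ∀ᶠ V in 𝓝 V₀, IsUnitaryCfg V → IsPeriodicCfg V (N : ℤ) →
            ∀ U : Site 4 → Fin 4 → (Matrix n n ℂ)ˣ, IsMinimiser 4 (sfClass 4 L N ε) L N (j + 1) V U →
            ∀ u : Site 4 → (Matrix n n ℂ)ˣ, IsUnitarySite u → IsPeriodicSite u ((N * L ^ (j + 1) : ℕ) : ℤ) →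
              (∀ (z : Site 4) (κ : Fin 4), (u (((L : ℤ) ^ (j + 1)) • z) : Matrix n n ℂ) * (V₀ z κ : Matrix n n ℂ)
                * (((u (((L : ℤ) ^ (j + 1)) • (z + e κ)))⁻¹ : (Matrix n n ℂ)ˣ) : Matrix n n ℂ) = V₀ z κ) →
              (∑ rκ : (Fin 4 → Fin (L * tower L N j)) × Fin 4, ‖(((Us (boxVec (L * tower L N j) rκ.1) rκ.2)⁻¹ : (Matrix n n ℂ)ˣ) : Matrix n n ℂ)
                  * ((gaugeAct u U (boxVec (L * tower L N j) rκ.1) rκ.2 : (Matrix n n ℂ)ˣ) : Matrix n n ℂ) - 1‖) ≤ δ₁ →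
              ∃ uc : Site 4 → (Matrix n n ℂ)ˣ, IsUnitarySite uc ∧ IsPeriodicSite uc ((N * L ^ (j + 1) : ℕ) : ℤ) ∧
                (∀ (z : Site 4) (κ : Fin 4), (uc (((L : ℤ) ^ (j + 1)) • z) : Matrix n n ℂ) * (V₀ z κ : Matrix n n ℂ)
                  * (((uc (((L : ℤ) ^ (j + 1)) • (z + e κ)))⁻¹ : (Matrix n n ℂ)ˣ) : Matrix n n ℂ) = V₀ z κ) ∧
                (∑ rκ : (Fin 4 → Fin (L * tower L N j)) × Fin 4, ‖(((Us (boxVec (L * tower L N j) rκ.1) rκ.2)⁻¹ : (Matrix n n ℂ)ˣ) : Matrix n n ℂ)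
                  * ((gaugeAct uc U (boxVec (L * tower L N j) rκ.1) rκ.2 : (Matrix n n ℂ)ˣ) : Matrix n n ℂ) - 1‖)
                  ≤ A * Real.sqrt (‖skewPR N (relLog N V₀ V)‖ *
                      ∑ rκ : (Fin 4 → Fin (L * tower L N j)) × Fin 4, ‖(((Us (boxVec (L * tower L N j) rκ.1) rκ.2)⁻¹ : (Matrix n n ℂ)ˣ) : Matrix n n ℂ)
                        * ((gaugeAct u U (boxVec (L * tower L N j) rκ.1) rκ.2 : (Matrix n n ℂ)ˣ) : Matrix n n ℂ) - 1‖)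
                    + B * ‖skewPR N (relLog N V₀ V)‖ := by
  have hL1 : 1 ≤ L := by omega
  have hL0 : (0 : ℝ) < L := by exact_mod_cast (show 0 < L by omega)
  obtain ⟨ε₁, hε₁, H⟩ := thresholds (n := n) hL
  obtain ⟨c₀, hc₀, ε₅, hε₅, H5⟩ := action_quadratic_growth_any_datum (n := n) hL
  refine ⟨min ε₁ ε₅, lt_min hε₁ hε₅, fun ε hε hεle N _ hN => ?_⟩
  obtain ⟨-, -, hls, H1⟩ := H ε hε (hεle.trans (min_le_left _ _))
  obtain ⟨δ₁, hδ₁, hint₁⟩ := H1 N hN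
  have hquad := H5 ε hε (hεle.trans (min_le_right _ _)) N hN
  refine ⟨δ₁, hδ₁, fun V₀ hV₀ j => ?_⟩
  obtain ⟨hV₀u, hV₀P, hV₀δ⟩ := hV₀
  obtain ⟨Us, hUs, a, ha0, haε, hUsa⟩ := hint₁ V₀ ⟨hV₀u, hV₀P, hV₀δ⟩ (j + 1)
  have hcritUs := tanCritical_of_isMinimiser hL1 hN hUs ha0 haε hUsa (hls j)
  have hq := hquad V₀ j Us hUs.mem hcritUs
  set M : ℕ := L * tower L N j with hMdef
  have hper : N * L ^ (j + 1) = M := by rw [hMdef]; exact period_succ_eq L N j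
  haveI : NeZero M := ⟨by rw [← hper]; exact Nat.mul_ne_zero (NeZero.ne N) (pow_ne_zero _ (by omega))⟩
  have hM1 : 1 ≤ N * L ^ (j + 1) := Nat.mul_pos hN (Nat.pow_pos (by omega))
  have hUsU : IsUnitaryCfg Us := hUs.mem.1.1
  have hUsP : IsPeriodicCfg Us (M : ℤ) := by have h := hUs.mem.1.2.1; rwa [hper] at h
  have eP : ((N * L ^ (j + 1) : ℕ) : ℤ) = (L : ℤ) * (tower L N j : ℕ) := by rw [tower_eq]; push_cast; ring
  have hUsP' : IsPeriodicCfg Us ((L : ℤ) * (tower L N j : ℕ)) := by rw [← eP]; exact hUs.mem.1.2.1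
  have hUsavg : cavgIter L (j + 1) Us = V₀ := by rw [cavgIter_eq_avgIter]; exact hUs.mem.2
  set x₀ : ℝ := ε / ((L : ℝ) ^ (j + 1)) ^ 2 with hx₀
  have hx₀0 : 0 ≤ x₀ := by positivity
  set P : ℝ := (L : ℝ) ^ (j + 1) with hPdef
  have hP1 : 1 ≤ P := one_le_pow₀ (by exact_mod_cast hL1)
  have hP0 : 0 < P := by linarith
  set w : ℝ := ((stepWt 4 L)⁻¹) ^ (j + 1) with hw
  have hw0 : 0 < w := pow_pos (inv_pos.mpr (stepWt_pos (d := 4) L hL1)) _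
  have hlev : ∀ Z : Site 4 → Fin 4 → (Matrix n n ℂ)ˣ, levelAction 4 L N (j + 1) Z = w * fineAction Z (perWin 4 (N * L ^ (j + 1))) := fun Z => by rw [hw]; rfl
  obtain ⟨θ, Kθ, ρ₀, hKθ, hρ₀, hθ0, hθc, hθL, hθid, hθfib⟩ := fibre_straightening (d := 4) (n := n) hL1 hε.le (hls j) hUs.mem haε hUsa
  obtain ⟨κ₁, C₁, Cg, ρ₁, hκ₁, hC₁, hCg, hρ₁, hF1⟩ :=
    chart_fibre_quantitative (d := 4) (n := n) hL1 hε.le (hls j) hUs.mem haε hUsa (perWin 4 (N * L ^ (j + 1)))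
  obtain ⟨CL', hCL', hnearStab⟩ := near_stabiliser (d := 4) (n := n) hV₀u hV₀P
  set ch : ↥(skewSub 4 n M) → (Site 4 → Fin 4 → (Matrix n n ℂ)ˣ) := fun Φ => chart (ContinuousLinearMap.id ℝ (Matrix n n ℂ)) M Us (Φ : TDir 4 n M) with hch
  set f : ↥(skewSub 4 n N) × ↥(skewSub 4 n M) → ℝ := fun p => fineAction (ch (θ p)) (perWin 4 (N * L ^ (j + 1))) with hfdef
  have hf2 : ContDiffAt ℝ 2 f 0 := by
    have hA : ContDiffAt ℝ 2 (fun Φ : ↥(skewSub 4 n M) => fineAction (ch Φ) (perWin 4 (N * L ^ (j + 1)))) (θ 0) := by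
      rw [hθ0]
      exact (contDiffAt_fineAction_chart (m := 2) (ContinuousLinearMap.id ℝ (Matrix n n ℂ)) M Us (perWin 4 (N * L ^ (j + 1))) _).comp (0 : ↥(skewSub 4 n M))
        (skewSub 4 n M).subtypeL.contDiff.contDiffAt
    exact hA.comp 0 hθc
  obtain ⟨KR, rR, hKR, hrR, hrect⟩ := rectangle_bound_of_contDiffAt_two hf2
  have hval0 : Tendsto (fun Φ : ↥(skewSub 4 n M) => (Φ : TDir 4 n M)) (𝓝 0) (𝓝 0) := by
    have h := continuous_subtype_val.tendsto (0 : ↥(skewSub 4 n M)); rwa [Submodule.coe_zero] at h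
  have hV3' : ∀ᶠ η : TDir 4 n M in 𝓝 0, ∀ (r : Fin 4 → Fin N) (κ' : Fin 4),
      ‖(((V₀ (boxVec N r) κ')⁻¹ : (Matrix n n ℂ)ˣ) : Matrix n n ℂ)
        * (cavgIter L (j + 1) (chart (ContinuousLinearMap.id ℝ (Matrix n n ℂ)) M Us η) (boxVec N r) κ' : Matrix n n ℂ) - 1‖ ≤ 1 / 4 := by
    refine Filter.eventually_all.mpr fun r => Filter.eventually_all.mpr fun κ' => ?_
    have hc0 := continuousAt_cavgIter_chart (d := 4) (n := n) hL1 N j (ContinuousLinearMap.id ℝ (Matrix n n ℂ)) hUsU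
      hUsP' hx₀0 (hls j) hUs.mem.1.2.2 (boxVec N r) κ'
    have hcn : ContinuousAt (fun η : TDir 4 n M => ‖(((V₀ (boxVec N r) κ')⁻¹ : (Matrix n n ℂ)ˣ) : Matrix n n ℂ)
        * ((cavgIter L (j + 1) (chart (ContinuousLinearMap.id ℝ (Matrix n n ℂ)) M Us η) (boxVec N r) κ' : (Matrix n n ℂ)ˣ) : Matrix n n ℂ) - 1‖) 0 :=
      ((continuousAt_const.mul hc0).sub continuousAt_const).norm
    have h0 : ‖(((V₀ (boxVec N r) κ')⁻¹ : (Matrix n n ℂ)ˣ) : Matrix n n ℂ)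
        * ((cavgIter L (j + 1) (chart (ContinuousLinearMap.id ℝ (Matrix n n ℂ)) M Us 0) (boxVec N r) κ' : (Matrix n n ℂ)ˣ) : Matrix n n ℂ) - 1‖ < 1 / 4 := by
      rw [chart_zero, hUsavg, Units.inv_mul, sub_self, norm_zero]; norm_num
    exact (hcn.eventually (gt_mem_nhds h0)).mono fun η hη => hη.le
  have hV3 : ∀ᶠ Φ : ↥(skewSub 4 n M) in 𝓝 0, ∀ (r : Fin 4 → Fin N) (κ' : Fin 4),
      ‖(((V₀ (boxVec N r) κ')⁻¹ : (Matrix n n ℂ)ˣ) : Matrix n n ℂ) * (cavgIter L (j + 1) (ch Φ) (boxVec N r) κ' : Matrix n n ℂ) - 1‖ ≤ 1 / 4 :=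
    hval0.eventually hV3'
  obtain ⟨ρ₂, hρ₂, hball₂⟩ := Metric.mem_nhds_iff.mp hV3
  set Cb : ℝ := (Fintype.card ((Fin 4 → Fin M) × Fin 4) : ℝ) with hCb
  have hCb0 : 0 ≤ Cb := by positivity
  set ρm : ℝ := min ρ₀ (min rR (min ρ₁ (min ρ₂ 1))) with hρm
  have hρm0 : 0 < ρm := lt_min hρ₀ (lt_min hrR (lt_min hρ₁ (lt_min hρ₂ one_pos)))
  have hρmρ₀ : ρm ≤ ρ₀ := min_le_left _ _
  have hρmrR : ρm ≤ rR := (min_le_right _ _).trans (min_le_left _ _)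
  have hρmρ₁ : ρm ≤ ρ₁ := (min_le_right _ _).trans ((min_le_right _ _).trans (min_le_left _ _))
  have hρmρ₂ : ρm ≤ ρ₂ := (min_le_right _ _).trans ((min_le_right _ _).trans ((min_le_right _ _).trans (min_le_left _ _)))
  have hρm1 : ρm ≤ 1 := (min_le_right _ _).trans ((min_le_right _ _).trans ((min_le_right _ _).trans (min_le_right _ _)))
  set e₀ : ℝ := min (ρm / 16) (1 / (4 * Cg + 4)) with he₀
  have he₀0 : 0 < e₀ := lt_min (by positivity) (by positivity)
  have he₀ρ : e₀ ≤ ρm / 16 := min_le_left _ _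
  have he₀g : e₀ ≤ 1 / (4 * Cg + 4) := min_le_right _ _
  set τ₀ : ℝ := min (ρm / 4) (min (4 * c₀ * e₀ ^ 2 / (P ^ 2 * KR * ρm + 1)) (1 / (4 * Kθ + 4))) with hτ₀
  have hτ₀0 : 0 < τ₀ := lt_min (by positivity) (lt_min (by positivity) (by positivity))
  set A : ℝ := Cb * ((16 * CL' * Cg + 2) * P) * Real.sqrt (2 * KR / c₀) with hAdef
  set B : ℝ := 3 * Cb * Kθ with hBdef
  refine ⟨Us, hUs, ρm / 8, A, B, by positivity, by positivity, by positivity, ?_⟩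
  have hnear := eventually_near_base (d := 4) (n := n) N V₀
  have hcoord : ∀ᶠ V in 𝓝 V₀, ‖skewPR N (relLog N V₀ V)‖ < τ₀ := by
    have h := tendsto_skewPR_relLog (d := 4) (n := n) N V₀
    have hb : Metric.ball (0 : ↥(skewSub 4 n N)) τ₀ ∈ 𝓝 (0 : ↥(skewSub 4 n N)) := Metric.ball_mem_nhds _ hτ₀0
    have h2 : ∀ᶠ V in 𝓝 V₀, skewPR N (relLog N V₀ V) ∈ Metric.ball (0 : ↥(skewSub 4 n N)) τ₀ := h hb
    exact h2.mono fun V hV => by simpa [dist_zero_right] using hV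
  filter_upwards [hnear, hcoord] with V hVnear hVt hVu hVP U hU u hu huP hufix hΨ
  set t : ℝ := ‖skewPR N (relLog N V₀ V)‖ with ht
  have ht0 : 0 ≤ t := norm_nonneg _
  have htρ : t < ρm / 4 := hVt.trans_le (min_le_left _ _)
  have htτ₁ : t ≤ 4 * c₀ * e₀ ^ 2 / (P ^ 2 * KR * ρm + 1) := hVt.le.trans ((min_le_right _ _).trans (min_le_left _ _))
  have htτ₂ : t ≤ 1 / (4 * Kθ + 4) := hVt.le.trans ((min_le_right _ _).trans (min_le_right _ _))
  set Ψ : (Site 4 → (Matrix n n ℂ)ˣ) → ℝ := fun v => ∑ rκ : (Fin 4 → Fin M) × Fin 4,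
    ‖(((Us (boxVec M rκ.1) rκ.2)⁻¹ : (Matrix n n ℂ)ˣ) : Matrix n n ℂ) * ((gaugeAct v U (boxVec M rκ.1) rκ.2 : (Matrix n n ℂ)ˣ) : Matrix n n ℂ) - 1‖ with hΨdef
  have hΨu : Ψ u ≤ ρm / 8 := hΨ
  have hΨ0 : 0 ≤ Ψ u := Finset.sum_nonneg fun _ _ => norm_nonneg _
  set ub : Site 4 → (Matrix n n ℂ)ˣ := fun z : Site 4 => u (((L : ℤ) ^ (j + 1)) • z) with hub
  have hubu : IsUnitarySite ub := fun z => isUnitarySite_corner hu _ z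
  have hfixU : gaugeAct ub V₀ = V₀ := by
    funext z κ
    exact Units.ext (by have h := hufix z κ; simpa only [hub, gaugeAct, Units.val_mul] using h)
  set X : Site 4 → Fin 4 → (Matrix n n ℂ)ˣ := gaugeAct u U with hXdef
  have hXmin : IsMinimiser 4 (sfClass 4 L N ε) L N (j + 1) (gaugeAct ub V) X := isMinimiser_gaugeAct hL1 hε.le j (hls j) hU hu huP
  have hXu : IsUnitaryCfg X := hXmin.mem.1.1
  have hXP : IsPeriodicCfg X (M : ℤ) := by have h := hXmin.mem.1.2.1; rwa [hper] at h
  have hXavg : cavgIter L (j + 1) X = gaugeAct ub V := by rw [cavgIter_eq_avgIter]; exact hXmin.mem.2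
  have hV'near : ∀ (r : Fin 4 → Fin N) (κ' : Fin 4),
      ‖(((V₀ (boxVec N r) κ')⁻¹ : (Matrix n n ℂ)ˣ) : Matrix n n ℂ) * ((gaugeAct ub V (boxVec N r) κ' : (Matrix n n ℂ)ˣ) : Matrix n n ℂ) - 1‖ ≤ 1 / 4 := fun r κ' => by
    rw [near_gaugeAct_stab hubu hfixU]; exact hVnear r κ'
  have hyeq : ‖skewPR N (relLog N V₀ (gaugeAct ub V))‖ = t := norm_skewPR_relLog_gaugeAct_stab hubu hfixU hVnear
  have hterm : ∀ (r : Fin 4 → Fin M) (κ' : Fin 4),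
      ‖(((Us (boxVec M r) κ')⁻¹ : (Matrix n n ℂ)ˣ) : Matrix n n ℂ) * ((X (boxVec M r) κ' : (Matrix n n ℂ)ˣ) : Matrix n n ℂ) - 1‖ ≤ Ψ u := fun r κ' =>
    term_le_sum (f := fun rκ : (Fin 4 → Fin M) × Fin 4 => ‖(((Us (boxVec M rκ.1) rκ.2)⁻¹ : (Matrix n n ℂ)ˣ) : Matrix n n ℂ)
      * ((gaugeAct u U (boxVec M rκ.1) rκ.2 : (Matrix n n ℂ)ˣ) : Matrix n n ℂ) - 1‖) (fun _ => norm_nonneg _) (r, κ')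
  set Φa : ↥(skewSub 4 n M) := skewPR M (relLog M Us X) with hΦa
  have hdec : ch Φa = X := chart_skewPR_relLog_eq hUsU hXu hUsP hXP fun r κ' => (hterm r κ').trans (by linarith)
  have hφ : ‖Φa‖ ≤ 2 * Ψ u := norm_skewPR_relLog_le hΨ0 (by linarith) hterm
  have hφρ : ‖Φa‖ ≤ ρm / 4 := by linarith
  set y₁ : ↥(skewSub 4 n N) := levelQ L N j Us (ch Φa) with hy₁
  have hy₁eq : y₁ = skewPR N (relLog N V₀ (gaugeAct ub V)) := by
    show skewPR N (relLog N (cavgIter L (j + 1) Us) (cavgIter L (j + 1) (ch Φa))) = _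
    rw [hdec, hUsavg, hXavg]
  have hy₁n : ‖y₁‖ = t := by rw [hy₁eq, hyeq]
  have hnpa : ‖((y₁, Φa) : ↥(skewSub 4 n N) × ↥(skewSub 4 n M))‖ < ρm := by
    rw [Prod.norm_mk, hy₁n]; exact max_lt (by linarith) (by linarith)
  have hnu : ‖((y₁, (0 : ↥(skewSub 4 n M))) : ↥(skewSub 4 n N) × ↥(skewSub 4 n M))‖ = t := by rw [Prod.norm_mk, norm_zero, hy₁n, max_eq_left ht0]
  have hnv : ‖(((0 : ↥(skewSub 4 n N)), Φa) : ↥(skewSub 4 n N) × ↥(skewSub 4 n M))‖ = ‖Φa‖ := by rw [Prod.norm_mk, norm_zero, max_eq_right (norm_nonneg _)]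
  have hθa : θ (y₁, Φa) = Φa := hθid Φa (by linarith)
  obtain ⟨hQa, hmema, hadma⟩ := hθfib (0, Φa) (by rw [hnv]; linarith)
  obtain ⟨hQb, hmemb, hadmb⟩ := hθfib (y₁, 0) (by rw [hnu]; linarith)
  have hV₀near : ∀ (r : Fin 4 → Fin N) (κ' : Fin 4),
      ‖(((V₀ (boxVec N r) κ')⁻¹ : (Matrix n n ℂ)ˣ) : Matrix n n ℂ) * (V₀ (boxVec N r) κ' : Matrix n n ℂ) - 1‖ ≤ 1 / 4 := fun r κ' => by
    rw [Units.inv_mul, sub_self, norm_zero]; norm_num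
  have hadm_a := hadma V₀ hV₀u hV₀P hV₀near (by rw [relLog_self, map_zero])
  obtain ⟨hV'u, -, -⟩ := cavgIter_unitary_small hL1 j hXu hx₀0 (hls j) hXmin.mem.1.2.2
  rw [hXavg] at hV'u
  have hV'P : IsPeriodicCfg (gaugeAct ub V) (N : ℤ) := by
    have hXPt : IsPeriodicCfg X ((tower L N (j + 1) : ℕ) : ℤ) := by rw [natCast_tower_succ, ← eP]; exact hXmin.mem.1.2.1
    have h := isPeriodicCfg_cavgIter L N (j + 1) hXPt
    rwa [hXavg] at h
  have hadm_b := hadmb (gaugeAct ub V) hV'u hV'P hV'near (by rw [← hy₁eq])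
  have hLa : ‖θ (0, Φa) - Φa‖ ≤ Kθ * t := by
    have h := hθL (0, Φa) (y₁, Φa) (by rw [hnv]; linarith) (hnpa.trans_le hρmρ₀)
    rw [hθa] at h
    have e : ((0, Φa) : ↥(skewSub 4 n N) × ↥(skewSub 4 n M)) - (y₁, Φa) = (-y₁, 0) := by ext <;> simp
    rw [e, Prod.norm_mk, norm_neg, norm_zero, hy₁n, max_eq_left ht0] at h
    exact h
  have hR := hrect 0 (y₁, 0) (0, Φa) (mem_ball_self hrR) (by rw [zero_add, mem_ball_zero_iff, hnu]; linarith)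
    (by rw [zero_add, mem_ball_zero_iff, hnv]; linarith) (by rw [zero_add, Prod.mk_add_mk, add_zero, zero_add, mem_ball_zero_iff]; linarith)
  rw [zero_add, zero_add, Prod.mk_add_mk, add_zero, zero_add, hnu, hnv] at hR
  have hfa : f (y₁, Φa) = fineAction X (perWin 4 (N * L ^ (j + 1))) := by simp only [hfdef, hθa, hdec]
  have hf0 : f 0 = fineAction Us (perWin 4 (N * L ^ (j + 1))) := by simp only [hfdef, hθ0, hch, Submodule.coe_zero, chart_zero]
  obtain ⟨u', X', hu', hu'P, hX's, hX'P, hgauge', hE⟩ := hq _ hadm_a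
  have hminb : fineAction X (perWin 4 (N * L ^ (j + 1))) ≤ fineAction (ch (θ (y₁, 0))) (perWin 4 (N * L ^ (j + 1))) := by
    have h := hXmin.le _ hadm_b
    rw [hlev, hlev] at h
    exact le_of_mul_le_mul_left h hw0
  set E : ℝ := energyNormW L (j + 1) Us X' (periodBox (d := 4) (N * L ^ (j + 1))) with hEdef
  have hE0 : 0 ≤ E := energyNormW_nonneg _ _ _ _ _
  have hE2 : c₀ * E ^ 2 ≤ KR * t * ‖Φa‖ := by
    have h1 : fineAction (ch (θ (0, Φa))) (perWin 4 (N * L ^ (j + 1))) - fineAction Us (perWin 4 (N * L ^ (j + 1)))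
        ≤ -(f (y₁, Φa) - f (y₁, 0) - f (0, Φa) + f 0) := by
      rw [hfa, hf0]; simp only [hfdef]; linarith
    exact hE.trans (h1.trans ((neg_le_abs _).trans hR))
  have hPE : P * E ≤ e₀ := by
    have h2 : c₀ * E ^ 2 ≤ KR * t * (ρm / 4) := hE2.trans (mul_le_mul_of_nonneg_left hφρ (by positivity))
    have h4 : t * (P ^ 2 * KR * ρm + 1) ≤ 4 * c₀ * e₀ ^ 2 := (le_div_iff₀ (by positivity : (0 : ℝ) < P ^ 2 * KR * ρm + 1)).mp htτ₁
    have h5 : c₀ * (P * E) ^ 2 ≤ c₀ * e₀ ^ 2 := by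
      have e1 : c₀ * (P * E) ^ 2 = P ^ 2 * (c₀ * E ^ 2) := by ring
      rw [e1]
      calc P ^ 2 * (c₀ * E ^ 2) ≤ P ^ 2 * (KR * t * (ρm / 4)) := mul_le_mul_of_nonneg_left h2 (sq_nonneg P)
        _ = (P ^ 2 * KR * ρm) * t / 4 := by ring
        _ ≤ (P ^ 2 * KR * ρm + 1) * t / 4 := by gcongr; linarith
        _ ≤ c₀ * e₀ ^ 2 := by linarith
    have h6 : (P * E) ^ 2 ≤ e₀ ^ 2 := le_of_mul_le_mul_left h5 hc₀
    exact (pow_le_pow_iff_left₀ (mul_nonneg hP0.le hE0) he₀0.le two_ne_zero).mp h6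
  have hEsq : E ≤ Real.sqrt (2 * KR / c₀) * Real.sqrt (t * Ψ u) := by
    rw [← Real.sqrt_mul (by positivity)]
    refine Real.le_sqrt_of_sq_le ?_
    have h := hE2.trans (mul_le_mul_of_nonneg_left hφ (by positivity))
    rw [div_mul_eq_mul_div, le_div_iff₀ hc₀]
    linarith
  have hX'n : ∀ (r : Fin 4 → Fin M) (κ' : Fin 4), ‖X' (boxVec M r) κ'‖ ≤ P * E := fun r κ' => by
    have hx : boxVec M r ∈ periodBox (d := 4) (N * L ^ (j + 1)) := by rw [hper]; exact mem_periodBox.2 fun i => ⟨by simp [boxVec], by simp [boxVec]⟩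
    exact norm_le_pow_mul_energyNormW_of_mem hL1 (j + 1) Us X' hx κ'
  have he₀1 : e₀ ≤ 1 / 16 := he₀ρ.trans (by linarith)
  set Y : Site 4 → Fin 4 → (Matrix n n ℂ)ˣ := vary Us X' 1 with hYdef
  have hYnear : ∀ (r : Fin 4 → Fin M) (κ' : Fin 4),
      ‖(((Us (boxVec M r) κ')⁻¹ : (Matrix n n ℂ)ˣ) : Matrix n n ℂ) * ((Y (boxVec M r) κ' : (Matrix n n ℂ)ˣ) : Matrix n n ℂ) - 1‖ ≤ 2 * (P * E) := fun r κ' =>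
    (norm_vary_sub_le (W := Us) (boxVec M r) κ' ((hX'n r κ').trans (hPE.trans (by linarith)))).trans (by linarith [hX'n r κ'])
  have hYu : IsUnitaryCfg Y := vary_isUnitaryCfg hUsU hX's 1
  have hYeq : Y = gaugeAct u' (ch (θ (0, Φa))) := hgauge'.symm
  have hYP : IsPeriodicCfg Y (M : ℤ) := by
    rw [hYeq, ← hper]; exact isPeriodicCfg_gaugeAct hu'P hmema.2.1
  set Φ'' : ↥(skewSub 4 n M) := skewPR M (relLog M Us Y) with hΦ''
  have hdecY : ch Φ'' = Y := chart_skewPR_relLog_eq hUsU hYu hUsP hYP fun r κ' => (hYnear r κ').trans (by linarith)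
  have hΦ''n : ‖Φ''‖ ≤ 4 * (P * E) := (norm_skewPR_relLog_le (by positivity) (by linarith) hYnear).trans (by linarith)
  have hΦ''ρ : ‖Φ''‖ < ρm := by linarith
  set ub' : Site 4 → (Matrix n n ℂ)ˣ := fun z : Site 4 => u' (((L : ℤ) ^ (j + 1)) • z) with hub'
  have hub'u : IsUnitarySite ub' := fun z => isUnitarySite_corner hu' _ z
  have hub'P : IsPeriodicSite ub' (N : ℤ) := by
    have h : IsPeriodicSite (fun z : Site 4 => u' (((L ^ (j + 1) : ℕ) : ℤ) • z)) (N : ℤ) := isPeriodicSite_corner hu'P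
    simpa only [Nat.cast_pow] using h
  have hYavg : cavgIter L (j + 1) Y = gaugeAct ub' V₀ := by
    rw [cavgIter_eq_avgIter, hYeq, avgIter_gaugeAct_sfClass hL1 hε.le j (hls j) hmema hu', ← cavgIter_eq_avgIter]
    show gaugeAct ub' (cavgIter L (j + 1) (ch (θ (0, Φa)))) = gaugeAct ub' V₀
    rw [cavgIter_eq_avgIter, hadm_a.2]
  set y' : ↥(skewSub 4 n N) := levelQ L N j Us (ch Φ'') with hy'
  have hy'eq : y' = skewPR N (relLog N V₀ (gaugeAct ub' V₀)) := by
    show skewPR N (relLog N (cavgIter L (j + 1) Us) (cavgIter L (j + 1) (ch Φ''))) = _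
    rw [hdecY, hUsavg, hYavg]
  have hy'n : ‖y'‖ ≤ Cg * (4 * (P * E)) := ((hF1 Φ'' (by linarith)).1).trans (mul_le_mul_of_nonneg_left hΦ''n hCg)
  have hy'1 : ‖y'‖ ≤ 1 := by
    have h1 : Cg * (4 * (P * E)) ≤ Cg * (4 * e₀) := mul_le_mul_of_nonneg_left (by linarith) hCg
    have h2 : Cg * (4 * e₀) ≤ 1 := by
      have h3 := (le_div_iff₀ (by positivity : (0:ℝ) < 4 * Cg + 4)).mp he₀g
      linarith [he₀0.le]
    linarith
  have hD'near := hball₂ (mem_ball_zero_iff.mpr (hΦ''ρ.trans_le hρmρ₂))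
  simp only [mem_setOf_eq] at hD'near
  rw [hdecY, hYavg] at hD'near
  have hD'u : IsUnitaryCfg (gaugeAct ub' V₀) := isUnitaryCfg_gaugeAct hub'u hV₀u
  have hD'P : IsPeriodicCfg (gaugeAct ub' V₀) (N : ℤ) := isPeriodicCfg_gaugeAct hub'P hV₀P
  have hdecD : chart (ContinuousLinearMap.id ℝ (Matrix n n ℂ)) N V₀ ((y' : ↥(skewSub 4 n N)) : TDir 4 n N) = gaugeAct ub' V₀ := by
    rw [hy'eq]; exact chart_skewPR_relLog_eq hV₀u hD'u hV₀P hD'P hD'near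
  have hdefect : ∀ (r : Fin 4 → Fin N) (κ' : Fin 4),
      ‖(((V₀ (boxVec N r) κ')⁻¹ : (Matrix n n ℂ)ˣ) : Matrix n n ℂ) * ((gaugeAct ub' V₀ (boxVec N r) κ' : (Matrix n n ℂ)ˣ) : Matrix n n ℂ) - 1‖ ≤ 8 * Cg * (P * E) := by
    intro r κ'
    have hcv : gaugeAct ub' V₀ = vary V₀ (chartDir (ContinuousLinearMap.id ℝ (Matrix n n ℂ)) N ((y' : ↥(skewSub 4 n N)) : TDir 4 n N)) 1 := by
      rw [← hdecD, ← chart_smul, one_smul]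
    have hcomp : ‖chartDir (ContinuousLinearMap.id ℝ (Matrix n n ℂ)) N ((y' : ↥(skewSub 4 n N)) : TDir 4 n N) (boxVec N r) κ'‖ ≤ ‖y'‖ := by
      simp only [chartDir, ContinuousLinearMap.id_apply]
      rw [Submodule.coe_norm]
      exact (norm_le_pi_norm (((y' : ↥(skewSub 4 n N)) : TDir 4 n N) (redN N (boxVec N r))) κ').trans (norm_le_pi_norm _ _)
    rw [hcv]
    exact (norm_vary_sub_le (W := V₀) (boxVec N r) κ' (hcomp.trans hy'1)).trans (by linarith)
  obtain ⟨s, hsu, hsP, hsfix, hsn⟩ := hnearStab ub' hub'u hub'P (8 * Cg * (P * E)) (by positivity) hdefect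
  set g'' : Site 4 → (Matrix n n ℂ)ˣ := fun z => s z * (ub' z)⁻¹ with hg''
  set u'' : Site 4 → (Matrix n n ℂ)ˣ := fun x => g'' (fun i => x i / ((L ^ (j + 1) : ℕ) : ℤ)) with hu''
  have hLj : 1 ≤ L ^ (j + 1) := Nat.one_le_pow _ _ (by omega)
  have hg''P : ∀ (z : Site 4) (i : Fin 4), g'' (z + (N : ℤ) • e i) = g'' z := fun z i => by simp only [hg'', hsP z i, hub'P z i]
  have hu''u : IsUnitarySite u'' := fun x => (unitaryUnits _).mul_mem (hsu _) ((unitaryUnits _).inv_mem (hub'u _))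
  have hu''P : IsPeriodicSite u'' ((N * L ^ (j + 1) : ℕ) : ℤ) := fun x i => blockConst_periodic hLj hg''P x i
  have hu''c : ∀ z : Site 4, u'' (((L : ℤ) ^ (j + 1)) • z) = s z * (ub' z)⁻¹ := fun z => by
    have h := blockConst_corner g'' hLj z
    simp only [Nat.cast_pow] at h
    exact h
  have hu''1 : ∀ x : Site 4, ‖(u'' x : Matrix n n ℂ) - 1‖ ≤ CL' * (8 * Cg * (P * E)) := by
    intro x
    have e0 : u'' x = s (fun i => x i / ((L ^ (j + 1) : ℕ) : ℤ)) * (ub' (fun i => x i / ((L ^ (j + 1) : ℕ) : ℤ)))⁻¹ := rfl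
    rw [e0, Units.val_mul, norm_mul_inv_sub_one _ (hub'u _)]
    exact hsn _
  set uc : Site 4 → (Matrix n n ℂ)ˣ := fun x => u'' x * (u' x * u x) with huc
  have hgc : gaugeAct uc U = gaugeAct u'' (gaugeAct u' X) := by
    funext x μ
    simp only [huc, hXdef, gaugeAct, mul_inv_rev]
    group
  refine ⟨uc, fun x => (unitaryUnits _).mul_mem (hu''u x) ((unitaryUnits _).mul_mem (hu' x) (hu x)),
    fun x i => by simp only [huc, hu''P x i, hu'P x i, huP x i], fun z κ' => ?_, ?_⟩
  · -- corner values `s·ū` fix `V₀`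
    have hufixU : ∀ (z : Site 4) (κ : Fin 4), ub z * V₀ z κ * (ub (z + e κ))⁻¹ = V₀ z κ := fun z κ => congr_fun (congr_fun hfixU z) κ
    have e1 : ∀ z : Site 4, uc (((L : ℤ) ^ (j + 1)) • z) = s z * ub z := fun z => by
      show u'' (((L : ℤ) ^ (j + 1)) • z) * (u' (((L : ℤ) ^ (j + 1)) • z) * u (((L : ℤ) ^ (j + 1)) • z)) = s z * ub z
      rw [hu''c]; simp only [hub', hub]; group
    rw [e1, e1]
    exact corner_fix_mul hsfix hufixU z κ'
  · -- the bond sum of the competitor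
    have hbond : ∀ rκ : (Fin 4 → Fin M) × Fin 4,
        ‖(((Us (boxVec M rκ.1) rκ.2)⁻¹ : (Matrix n n ℂ)ˣ) : Matrix n n ℂ)
          * ((gaugeAct uc U (boxVec M rκ.1) rκ.2 : (Matrix n n ℂ)ˣ) : Matrix n n ℂ) - 1‖
          ≤ (16 * CL' * Cg + 2) * P * E + 3 * Kθ * t := by
      rintro ⟨r, κ'⟩
      have hUsb : Us (boxVec M r) κ' ∈ unitaryUnits (Matrix n n ℂ) := hUsU (boxVec M r) κ'
      simp only
      rw [hgc, norm_relVal_eq hUsb]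
      set xb : Site 4 := boxVec M r with hxb
      set Z := gaugeAct u' X with hZ
      have hZu : IsUnitaryCfg Z := isUnitaryCfg_gaugeAct hu' hXu
      have T2 : ‖(Z xb κ' : Matrix n n ℂ) - (Y xb κ' : Matrix n n ℂ)‖ ≤ 3 * (Kθ * t) := by
        rw [hZ, hYeq, norm_gaugeAct_sub_gaugeAct hu', ← hdec]
        have hΦa1 : ‖(Φa : TDir 4 n M)‖ ≤ 1 := by rw [← Submodule.coe_norm]; linarith
        have hΦa'1 : ‖(θ (0, Φa) : TDir 4 n M)‖ ≤ 1 := by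
          rw [← Submodule.coe_norm]
          have h1 : ‖θ (0, Φa)‖ ≤ ‖θ (0, Φa) - Φa‖ + ‖Φa‖ := norm_le_norm_sub_add _ _
          have h2 : Kθ * t ≤ 1 / 4 := by
            have h3 := (le_div_iff₀ (by positivity : (0:ℝ) < 4 * Kθ + 4)).mp htτ₂
            linarith
          linarith
        refine (norm_chart_sub_chart_le hUsU hΦa1 hΦa'1 xb κ').trans ?_
        have e4 : ‖(Φa : TDir 4 n M) - (θ (0, Φa) : TDir 4 n M)‖ = ‖θ (0, Φa) - Φa‖ := by
          rw [norm_sub_rev, ← Submodule.coe_sub]; rfl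
        rw [e4]; linarith [hLa]
      have T3 : ‖(Y xb κ' : Matrix n n ℂ) - (Us xb κ' : Matrix n n ℂ)‖ ≤ 2 * (P * E) := by
        rw [← norm_relVal_eq hUsb]; exact hYnear r κ'
      have h3 := three_piece hu''u hZu Y Us xb κ'
      have h4 := hu''1 xb
      have h5 := hu''1 (xb + e κ')
      linarith
    calc (∑ rκ : (Fin 4 → Fin M) × Fin 4, ‖(((Us (boxVec M rκ.1) rκ.2)⁻¹ : (Matrix n n ℂ)ˣ) : Matrix n n ℂ)
            * ((gaugeAct uc U (boxVec M rκ.1) rκ.2 : (Matrix n n ℂ)ˣ) : Matrix n n ℂ) - 1‖)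
        ≤ ∑ _rκ : (Fin 4 → Fin M) × Fin 4, ((16 * CL' * Cg + 2) * P * E + 3 * Kθ * t) := Finset.sum_le_sum fun rκ _ => hbond rκ
      _ = Cb * ((16 * CL' * Cg + 2) * P * E + 3 * Kθ * t) := by rw [Finset.sum_const, nsmul_eq_mul, hCb, Finset.card_univ]
      _ ≤ Cb * ((16 * CL' * Cg + 2) * P * (Real.sqrt (2 * KR / c₀) * Real.sqrt (t * Ψ u)) + 3 * Kθ * t) := by
          gcongr
      _ = A * Real.sqrt (t * Ψ u) + B * t := by rw [hAdef, hBdef]; ring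

end

end Summit.QuantumFields.BalabanUV.T4Continuum.NE7MinimiserLipschitzStep
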